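import Mathlib
import Summits.Schanuel.Schanuel.Theorems.RigidCoreMinimalCounterexampleInAclNoFullLine
import Literature.NumberTheory.Transcendental.TrdegZariskiDim

/-!
# THE LINE VARIETY WITH DEAD DIRECTIONS — crux stmt-Schanuel-0969 `RigidCore.MinimalCounterexampleInAcl`

Line `kernel-arithmetic-selection` (lead prover-line-stmt-Schanuel-0969-c16-0), registered stub
`stub_lineVariety_deadDirections` (R2β, `--supports stmt-Schanuel-0969`): the first-failure-side DIMENSION DROP.

Let `x` be a first failure of Schanuel of rank `n`, `xm : ℤ → ℂⁿ` a family of MATES of `x` over `J ⊆ ℤ` taking at least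
two values, and `Λ ≤ ℤⁿ` a lattice of integer directions `M` whose value `M·xm_j` is constant ("dead") along the family.
Assuming the monomial slice variety R2α (`stub_monomialSliceVariety`, the antecedent of the registered implication), there
is a Zariski closed `W ⊆ ℂⁿ × ℂⁿ` containing every `(xm_j, e^{xm_j})` with `dim W + rank Λ < n`.  Proof:

1. RANK.  A ℤ-basis `M¹, …, Mᵐ` of `Λ` (`Submodule.basisOfPid`); a coordinate `i₁` that moves between two mates is not dead,
   so `e_{i₁}` is ℤ-independent of `Λ` (`LinearIndependent.finCons'`) and `m + 1 ≤ n`.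
2. CONSTANTS.  At the base mate `z = xm_{j₀}` the constants `bᵗ = Mᵗ·z` are ℚ-linearly independent (a mate is ℚ-independent;
   `LinearIndependent.iff_fractionRing` moves between ℤ and ℚ), and `e^{bᵗ} = ∏ (e^{z_i})^{Mᵗ_i}`.
3. COUNT.  `SchanuelRank m` (`m < n`, first failure) gives `m` algebraically independent elements among `(b, e^b)`
   (`exists_finset_algebraicIndependent_maximal` + `trdeg_adjoin_le_card`); extend them maximally by coordinates of
   `(z, e^z)` (`exists_finset_algebraicIndependent_sumElim`); everything lies in `L = ℚ(z, e^z)` of transcendence degree `< n`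
   (`z` is a first failure, `mate_firstFailure_voc`), so the added coordinate set `T` has `#T + m ≤ n − 1`, and by maximality
   every coordinate is algebraic over `ℚ[b, e^b, T]`.
4. R2α at `(M, J, P_j = (xm_j, e^{xm_j}), j₀, T)`: relations transfer between mates (`locusPts` equality), the additive values
   `Mᵗ·xm_j` are dead by hypothesis and the monomials `∏ (e^{xm_j i})^{Mᵗ_i} = e^{Mᵗ·xm_j}` with them; `dim W ≤ #T ≤ n − 1 − m`.

References: status note `Cruxes/MinimalCounterexampleInAcl/Lines/kernel_arithmetic_selection.md`; Kirby 2010, Prop. 7.2.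
-/

noncomputable section

set_option linter.dupNamespace false

open Complex Set

namespace Summit.Schanuel.Schanuel.Cruxes.MinimalCounterexampleInAcl.KernelArithmeticSelection

open Literature.NumberTheory.Transcendental

variable {n m : ℕ}

/-! ## Elementary identities -/

/-- `e^{M·z} = ∏ (e^{z_i})^{M_i}` for an integer vector `M`. [folklore] -/
theorem cexp_intCombination (z : Fin n → ℂ) (Mv : Fin n → ℤ) :
    cexp (∑ i, (Mv i : ℂ) * z i) = ∏ i, cexp (z i) ^ (Mv i : ℤ) := by
  rw [Complex.exp_sum]
  exact Finset.prod_congr rfl fun i _ => Complex.exp_int_mul (z i) (Mv i)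

/-- The value of the direction `c·e_{i₁}` at `z` is `c·z_{i₁}`. [folklore] -/
theorem sum_smul_single_mul (c : ℤ) (i₁ : Fin n) (z : Fin n → ℂ) :
    ∑ i, (((c • (Pi.single i₁ (1 : ℤ) : Fin n → ℤ)) i : ℤ) : ℂ) * z i = (c : ℂ) * z i₁ := by
  simp [Pi.single_apply]

/-! ## Step 1: the rank bound -/

/-- If no non-zero multiple of the coordinate vector `e_{i₁}` lies in a lattice `Λ ≤ ℤⁿ` with a basis indexed by `Fin m`,
then `m + 1 ≤ n` (`Fin.cons e_{i₁} (basis)` is ℤ-linearly independent in `ℤⁿ`). [folklore] -/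
theorem succ_le_of_single_notMem {Λ : Submodule ℤ (Fin n → ℤ)} (bΛ : Module.Basis (Fin m) ℤ Λ) (i₁ : Fin n)
    (h : ∀ c : ℤ, c • (Pi.single i₁ (1 : ℤ) : Fin n → ℤ) ∈ Λ → c = 0) : m + 1 ≤ n := by
  set M : Fin m → Fin n → ℤ := fun t => ((bΛ t : Λ) : Fin n → ℤ) with hM
  have hMli : LinearIndependent ℤ M := bΛ.linearIndependent.map' Λ.subtype (Submodule.ker_subtype Λ)
  have hspan : Submodule.span ℤ (Set.range M) ≤ Λ :=
    Submodule.span_le.2 (by rintro _ ⟨t, rfl⟩; exact (bΛ t).2)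
  have hcons : LinearIndependent ℤ (Fin.cons (Pi.single i₁ (1 : ℤ)) M : Fin (m + 1) → Fin n → ℤ) := by
    refine LinearIndependent.finCons' _ _ hMli fun c y hy hcy => h c ?_
    have : c • (Pi.single i₁ (1 : ℤ) : Fin n → ℤ) = -y := eq_neg_of_add_eq_zero_left hcy
    rw [this]
    exact Λ.neg_mem (hspan hy)
  have := hcons.fintype_card_le_finrank
  rw [Fintype.card_fin, Module.finrank_fintype_fun_eq_card, Fintype.card_fin] at this
  exact this

/-! ## Step 2: the constants are ℚ-linearly independent -/

/-- Integer combinations `Mᵗ·z` of a ℚ-linearly independent tuple `z` along ℤ-linearly independent integer vectors `Mᵗ`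
are ℚ-linearly independent. [folklore] -/
theorem linearIndependent_intCombos {z : Fin n → ℂ} (hz : LinearIndependent ℚ z)
    {M : Fin m → Fin n → ℤ} (hM : LinearIndependent ℤ M) :
    LinearIndependent ℚ (fun t => ∑ i, (M t i : ℂ) * z i) := by
  have hzℤ : LinearIndependent ℤ z := (LinearIndependent.iff_fractionRing ℤ ℚ).2 hz
  have hinj : LinearMap.ker (Fintype.linearCombination ℤ z) = ⊥ :=
    LinearMap.ker_eq_bot.2 hzℤ.fintypeLinearCombination_injective
  have h := hM.map' (Fintype.linearCombination ℤ z) hinj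
  rw [LinearIndependent.iff_fractionRing ℤ ℚ] at h
  have hfun : (⇑(Fintype.linearCombination ℤ z) ∘ M) = fun t => ∑ i, (M t i : ℂ) * z i := by
    funext t
    simp [Fintype.linearCombination_apply, zsmul_eq_mul]
  rw [hfun] at h
  exact h

/-! ## Step 3: maximal extension of an algebraically independent family by coordinates -/

/-- Given an algebraically independent family `w` and a point `P`, a finite set `T` of coordinates of `P`, maximal such
that `w` together with `P|_T` is algebraically independent; every coordinate of `P` is then algebraic over `ℚ[w, P|_T]`
(`AlgebraicIndependent.option_iff_transcendental`). [folklore] -/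
theorem exists_finset_algebraicIndependent_sumElim {κ ι : Type} [Fintype κ] [Fintype ι] (w : κ → ℂ) (P : ι → ℂ)
    (hw : AlgebraicIndependent ℚ w) :
    ∃ T : Finset ι, AlgebraicIndependent ℚ (Sum.elim w (fun i : T => P i)) ∧
      ∀ j, IsAlgebraic (Algebra.adjoin ℚ (Set.range (Sum.elim w (fun i : T => P i)))) (P j) := by
  classical
  let good : Finset ι → Prop := fun T => AlgebraicIndependent ℚ (Sum.elim w (fun i : T => P i))
  have hgood0 : good ∅ := by
    haveI : IsEmpty {i // i ∈ (∅ : Finset ι)} := ⟨fun i => Finset.notMem_empty i.1 i.2⟩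
    have h := (algebraicIndependent_equiv (Equiv.sumEmpty κ {i // i ∈ (∅ : Finset ι)})).2 hw
    show AlgebraicIndependent ℚ (Sum.elim w (fun i : (∅ : Finset ι) => P i))
    convert h using 1
    funext k
    rcases k with k | ⟨i, hi⟩
    · simp
    · exact absurd hi (Finset.notMem_empty i)
  have hne : ((Finset.univ : Finset (Finset ι)).filter good).Nonempty := ⟨∅, by simpa using hgood0⟩
  obtain ⟨T, hT, hmax⟩ := Finset.exists_max_image _ Finset.card hne
  simp only [Finset.mem_filter, Finset.mem_univ, true_and] at hT hmax
  refine ⟨T, hT, fun j => ?_⟩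
  by_contra htr
  set F : κ ⊕ T → ℂ := Sum.elim w (fun i : T => P i) with hF
  have hopt : AlgebraicIndependent ℚ (fun o : Option (κ ⊕ T) => o.elim (P j) F) :=
    (hT.option_iff_transcendental (P j)).mpr htr
  have hjT : j ∉ T := by
    intro hj
    exact htr (isAlgebraic_algebraMap
      (⟨P j, Algebra.subset_adjoin ⟨Sum.inr ⟨j, hj⟩, rfl⟩⟩ : Algebra.adjoin ℚ (Set.range F)))
  let f : κ ⊕ {i // i ∈ insert j T} → Option (κ ⊕ T) :=
    Sum.elim (fun k => some (Sum.inl k)) (fun i => if h : (i : ι) ∈ T then some (Sum.inr ⟨i, h⟩) else none)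
  have hf_of_not : ∀ i : {i // i ∈ insert j T}, (i : ι) ∉ T → (i : ι) = j := fun i hi => by
    have := i.2
    rw [Finset.mem_insert] at this
    tauto
  have hf : Function.Injective f := by
    rintro (a | a) (b | b) hab
    · simpa [f] using hab
    · by_cases hb : (b : ι) ∈ T <;> simp [f, hb] at hab
    · by_cases ha : (a : ι) ∈ T <;> simp [f, ha] at hab
    · by_cases ha : (a : ι) ∈ T <;> by_cases hb : (b : ι) ∈ T
      · simp only [f, ha, hb, Sum.elim_inr, dif_pos, Option.some.injEq, Sum.inr.injEq, Subtype.mk.injEq] at hab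
        exact congrArg Sum.inr (Subtype.ext hab)
      · simp [f, ha, hb] at hab
      · simp [f, ha, hb] at hab
      · exact congrArg Sum.inr (Subtype.ext ((hf_of_not a ha).trans (hf_of_not b hb).symm))
  have hgood : good (insert j T) := by
    have hcomp := hopt.comp f hf
    have hfun : ((fun o : Option (κ ⊕ T) => o.elim (P j) F) ∘ f) =
        Sum.elim w (fun i : {i // i ∈ insert j T} => P i) := by
      funext k
      rcases k with k | i
      · simp [f, hF]
      · by_cases h : (i : ι) ∈ T
        · simp [f, h, hF]
        · simp [f, hf_of_not i h, hjT]
    simpa only [good, hfun] using hcomp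
  have := hmax _ hgood
  rw [Finset.card_insert_of_notMem hjT] at this
  omega

/-! ## Step 4: the coordinate count at a first failure -/

/-- **The transcendence count.**  At a first failure `z` of rank `n`, for ℤ-linearly independent integer directions
`M¹, …, Mᵐ` with `m < n`, there is a finite set `T ⊆ ℂ` of coordinates of `(z, e^z)` with `#T + m + 1 ≤ n` such that every
coordinate of `(z, e^z)` is algebraic over `ℚ[b, e^b, T]`, `bᵗ = Mᵗ·z`, `e^{bᵗ} = ∏ (e^{z_i})^{Mᵗ_i}`: `SchanuelRank m` at the
ℚ-independent `b` inside `ℚ(z, e^z)` of transcendence degree `< n`. [cite: Kirby2010, Prop. 7.2] -/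
theorem exists_coordSet {z : Fin n → ℂ} (hz : z ∈ firstFailures n) {M : Fin m → Fin n → ℤ}
    (hM : LinearIndependent ℤ M) (hmn : m < n) :
    ∃ T : Finset ℂ, T.card + m + 1 ≤ n ∧ ∀ v : Fin n ⊕ Fin n,
      IsAlgebraic ↥(Algebra.adjoin ℚ (Set.range (fun t : Fin m => ∑ i, (M t i : ℂ) * z i) ∪
        Set.range (fun t : Fin m => ∏ i, cexp (z i) ^ (M t i : ℤ)) ∪ (↑T : Set ℂ))) (Sum.elim z (cexp ∘ z) v) := by
  classical
  set Pt : Fin n ⊕ Fin n → ℂ := Sum.elim z (cexp ∘ z) with hPt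
  set b : Fin m → ℂ := fun t => ∑ i, (M t i : ℂ) * z i with hb
  set β : Fin m → ℂ := fun t => ∏ i, cexp (z i) ^ (M t i : ℤ) with hβ
  have hbβ : cexp ∘ b = β := funext fun t => cexp_intCombination z (M t)
  have hbli : LinearIndependent ℚ b := linearIndependent_intCombos hz.1 hM
  set F₀ : Fin m ⊕ Fin m → ℂ := Sum.elim b β with hF₀
  -- Schanuel in rank `m`
  have hSR : (m : Cardinal) ≤ Algebra.trdeg ℚ ↥(IntermediateField.adjoin ℚ (range b ∪ range (cexp ∘ b))) :=
    hz.2.2 m hmn b hbli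
  obtain ⟨S₀, hS₀, hS₀alg⟩ := exists_finset_algebraicIndependent_maximal F₀
  have hcard := trdeg_adjoin_le_card F₀ S₀ hS₀alg
  rw [hF₀, Set.Sum.elim_range, ← hbβ] at hcard
  have hmS₀ : m ≤ S₀.card := by exact_mod_cast hSR.trans hcard
  -- maximal extension by coordinates
  obtain ⟨T', hT', hT'alg⟩ := exists_finset_algebraicIndependent_sumElim (fun i : S₀ => F₀ i) Pt hS₀
  -- everything lies in `L = ℚ(z, e^z)`, of transcendence degree `< n`
  set L : IntermediateField ℚ ℂ := IntermediateField.adjoin ℚ (range z ∪ range (cexp ∘ z)) with hL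
  have hzL : ∀ i, z i ∈ L := fun i => IntermediateField.subset_adjoin ℚ _ (Or.inl ⟨i, rfl⟩)
  have hezL : ∀ i, cexp (z i) ∈ L := fun i => IntermediateField.subset_adjoin ℚ _ (Or.inr ⟨i, rfl⟩)
  have hmemL : ∀ k, Sum.elim (fun i : S₀ => F₀ i) (fun i : T' => Pt i) k ∈ L := by
    rintro (⟨a, ha⟩ | ⟨v, hv⟩)
    · rcases a with t | t
      · show ∑ i, (M t i : ℂ) * z i ∈ L
        exact sum_mem fun i _ => mul_mem (intCast_mem L _) (hzL i)
      · show ∏ i, cexp (z i) ^ (M t i : ℤ) ∈ L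
        exact prod_mem fun i _ => zpow_mem (hezL i) _
    · rcases v with i | i
      · exact hzL i
      · exact hezL i
  let w : S₀ ⊕ T' → L := fun k => ⟨_, hmemL k⟩
  have hw : AlgebraicIndependent ℚ w := AlgebraicIndependent.of_comp L.val hT'
  have hle := hw.cardinalMk_le_trdeg
  simp only [Cardinal.mk_fintype, Fintype.card_sum, Fintype.card_coe] at hle
  have h1 : ((S₀.card + T'.card : ℕ) : Cardinal) ≤ Algebra.trdeg ℚ L := by exact_mod_cast hle
  have h2 : Algebra.trdeg ℚ L < (n : Cardinal) := hz.2.1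
  have hlt : S₀.card + T'.card < n := by exact_mod_cast h1.trans_lt h2
  refine ⟨T'.image Pt, ?_, fun v => (hT'alg v).tower_top_of_subalgebra_le (Algebra.adjoin_mono ?_)⟩
  · have := Finset.card_image_le (s := T') (f := Pt)
    omega
  · rintro _ ⟨k, rfl⟩
    rcases k with ⟨a, ha⟩ | ⟨v, hv⟩
    · rcases a with t | t
      · exact Or.inl (Or.inl ⟨t, rfl⟩)
      · exact Or.inl (Or.inr ⟨t, rfl⟩)
    · exact Or.inr (Finset.mem_coe.2 (Finset.mem_image_of_mem Pt hv))

/-! ## The registered stub -/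

/-- **Stub R2β — THE LINE VARIETY WITH DEAD DIRECTIONS (first-failure side; PROVED from R2α).**  R2α ⟹ for a first failure
`x` of rank `n`, a family `xm` of mates of `x` over `J ⊆ ℤ` taking at least two values, and a lattice `Λ ≤ ℤⁿ` of directions
constant along the family, there is a Zariski closed `W ⊆ ℂⁿ × ℂⁿ` containing every `(xm_j, e^{xm_j})` with `dim W + rank Λ < n`:
`rank Λ ≤ n − 1` (a coordinate that moves is not dead), a ℤ-basis `M` of `Λ` gives ℚ-linearly independent constants
`bᵗ = Mᵗ·xm_j`, `SchanuelRank (rank Λ)` and `trdeg ℚ(xm_{j₀}, e^{xm_{j₀}}) < n` bound the coordinate set `T` (`exists_coordSet`),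
and R2α with this `T` (relations transfer between mates by `locusPts` equality, `mate_firstFailure_voc`).
[cite: Kirby2010, Prop. 7.2] -/
theorem stub_lineVariety_deadDirections : (∀ (n s : ℕ) (M : Fin s → Fin n → ℤ) (J : Set ℤ) (P : ℤ → Fin n ⊕ Fin n → ℂ) (j₀ : ℤ), j₀ ∈ J → (∀ j ∈ J, ∀ i : Fin n, P j (Sum.inr i) ≠ 0) → (∀ j ∈ J, ∀ G : MvPolynomial (Fin n ⊕ Fin n) ℚ, MvPolynomial.aeval (P j₀) G = 0 → MvPolynomial.aeval (P j) G = 0) → (∀ t : Fin s, ∀ j ∈ J, (∑ i, (M t i : ℂ) * P j (Sum.inl i)) = ∑ i, (M t i : ℂ) * P j₀ (Sum.inl i)) → (∀ t : Fin s, ∀ j ∈ J, (∏ i, P j (Sum.inr i) ^ (M t i : ℤ)) = ∏ i, P j₀ (Sum.inr i) ^ (M t i : ℤ)) → ∀ T : Finset ℂ, (∀ v : Fin n ⊕ Fin n, IsAlgebraic ↥(Algebra.adjoin ℚ (Set.range (fun t : Fin s => ∑ i, (M t i : ℂ) * P j₀ (Sum.inl i)) ∪ Set.range (fun t : Fin s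 => ∏ i, P j₀ (Sum.inr i) ^ (M t i : ℤ)) ∪ (↑T : Set ℂ))) (P j₀ v)) → ∃ W : Set (Fin n ⊕ Fin n → ℂ), Literature.NumberTheory.Transcendental.IsZariskiClosed ℂ W ∧ Literature.NumberTheory.Transcendental.zariskiDim ℂ W ≤ ((T.card : ℕ) : WithBot ℕ∞) ∧ ∀ j ∈ J, P j ∈ W) → ∀ (n : ℕ) (x : Fin n → ℂ), x ∈ Summit.Schanuel.Schanuel.Cruxes.MinimalCounterexampleInAcl.KernelArithmeticSelection.firstFailures n → ∀ (J : Set ℤ) (xm : ℤ → Fin n → ℂ), (∀ j ∈ J, xm j ∈ Summit.Schanuel.Schanuel.Cruxes.MinimalCounterexampleInAcl.KernelArithmeticSelection.locusMates x) → (∃ j ∈ J, ∃ j' ∈ J, xm j ≠ xm j') → ∀ Λ : Submodule ℤ (Fin n → ℤ), (∀ M ∈ Λ, ∀ j ∈ J, ∀ j' ∈ J, (∑ i, (M i : ℂ) * xm j i) = ∑ i, (M i : ℂ) * xm j' i) → ∃ W : Set (Fin n ⊕ Fin n → ℂ), Literature.NumberTheory.Transcendental.IsZariskiClosed ℂ W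 ∧ Literature.NumberTheory.Transcendental.zariskiDim ℂ W + ((Module.finrank ℤ ↥Λ : ℕ) : WithBot ℕ∞) < ((n : ℕ) : WithBot ℕ∞) ∧ ∀ j ∈ J, Sum.elim (xm j) (Complex.exp ∘ xm j) ∈ W := by
  intro hα n x hx J xm hmates hne Λ hdead
  classical
  obtain ⟨j₁, hj₁, j₂, hj₂, hne12⟩ := hne
  obtain ⟨i₁, hi₁⟩ := Function.ne_iff.1 hne12
  -- a ℤ-basis of `Λ`
  obtain ⟨m, bΛ⟩ := Submodule.basisOfPid (Pi.basisFun ℤ (Fin n)) Λ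
  have hfin : Module.finrank ℤ Λ = m := by
    rw [Module.finrank_eq_card_basis bΛ, Fintype.card_fin]
  rw [hfin]
  set M : Fin m → Fin n → ℤ := fun t => ((bΛ t : Λ) : Fin n → ℤ) with hMdef
  have hMmem : ∀ t, M t ∈ Λ := fun t => (bΛ t).2
  have hM : LinearIndependent ℤ M := bΛ.linearIndependent.map' Λ.subtype (Submodule.ker_subtype Λ)
  -- the rank bound: the moving coordinate `i₁` is not dead
  have hmn : m + 1 ≤ n := by
    refine succ_le_of_single_notMem bΛ i₁ fun c hc => ?_
    by_contra hc0
    have h := hdead _ hc j₁ hj₁ j₂ hj₂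
    rw [sum_smul_single_mul, sum_smul_single_mul] at h
    exact hi₁ (mul_left_cancel₀ (Int.cast_ne_zero.2 hc0) h)
  -- the base mate `xm j₁` is a first failure with the same locus
  obtain ⟨hff₁, hlocus₁⟩ := mate_firstFailure_voc hx (hmates j₁ hj₁)
  obtain ⟨T, hTcard, hTalg⟩ := exists_coordSet hff₁ hM (by omega)
  -- the hypotheses of R2α for the mate family `P j = (xm j, e^{xm j})` based at `j₁`
  have hrel : ∀ j ∈ J, ∀ G : MvPolynomial (Fin n ⊕ Fin n) ℚ,
      MvPolynomial.aeval (Sum.elim (xm j₁) (cexp ∘ xm j₁)) G = 0 →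
      MvPolynomial.aeval (Sum.elim (xm j) (cexp ∘ xm j)) G = 0 := by
    intro j hj G hG
    have hjl : xm j ∈ locusPts (xm j₁) := by
      rw [hlocus₁]
      exact (hmates j hj).2
    exact hjl G hG
  have hadd : ∀ t : Fin m, ∀ j ∈ J, (∑ i, (M t i : ℂ) * xm j i) = ∑ i, (M t i : ℂ) * xm j₁ i :=
    fun t j hj => hdead _ (hMmem t) j hj j₁ hj₁
  have hmul : ∀ t : Fin m, ∀ j ∈ J, (∏ i, cexp (xm j i) ^ (M t i : ℤ)) = ∏ i, cexp (xm j₁ i) ^ (M t i : ℤ) := by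
    intro t j hj
    rw [← cexp_intCombination, ← cexp_intCombination, hdead _ (hMmem t) j hj j₁ hj₁]
  obtain ⟨W, hWcl, hWdim, hWmem⟩ := hα n m M J (fun j => Sum.elim (xm j) (cexp ∘ xm j)) j₁ hj₁
    (fun j _ i => Complex.exp_ne_zero _) hrel hadd hmul T hTalg
  refine ⟨W, hWcl, ?_, hWmem⟩
  calc zariskiDim ℂ W + (m : WithBot ℕ∞) ≤ ((T.card : ℕ) : WithBot ℕ∞) + (m : WithBot ℕ∞) := add_le_add hWdim le_rfl
    _ < ((n : ℕ) : WithBot ℕ∞) := by exact_mod_cast (show T.card + m < n by omega)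

end Summit.Schanuel.Schanuel.Cruxes.MinimalCounterexampleInAcl.KernelArithmeticSelection

end
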